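import Literature.GroupTheory.ProP.ProPFrattiniOpen
import Literature.GroupTheory.Nilpotent.OperatorCommutatorWidth
import Mathlib.Topology.Algebra.ClopenNhdofOne
import Mathlib.Topology.Algebra.OpenSubgroup
import Mathlib.Topology.Algebra.Group.ClosedSubgroup
import Mathlib.GroupTheory.FiniteAbelian.Basic
import HarnessLib

/-!
# Serre's lemma for operator groups: the abstract operator-Frattini subgroup of a normally
# finitely generated normal pro-`p` subgroup is closed and relatively open

J.-P. Serre, *Galois Cohomology*, I §4.2, exercise 6; J. D. Dixon, M. P. F. du Sautoy, A. Mann,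
D. Segal, *Analytic pro-`p` groups* (2nd ed.), Ch. 1, Prop. 1.19, Thm. 1.17 prove: in a topologically
finitely generated pro-`p` group the abstract subgroup `G^p [G, G]` is open (tree:
`Literature/GroupTheory/ProP/ProPFrattiniOpen.lean`).  This file proves the RELATIVE ("operator")
version.  Let `G` be a profinite group (compact, totally disconnected), topologically generated by
`g₁, …, g_d`, and let `P ⊴ G` be a CLOSED normal subgroup which is PRO-`p` (every `x ∈ P` has
`x ^ (p ^ a) → 1`) and is the topological normal closure of finitely many elements `y₁, …, y_n ∈ P`.
Let `M = ⟨w ^ p, ⁅w, c⁆ : w ∈ P, c ∈ G⟩` be the ABSTRACT subgroup generated by the `p`-th powers of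
elements of `P` and their commutators with arbitrary elements of `G`.

* `exists_eq_word_of_mem_operatorFrattiniClosure` — every element of the closure of `M` is a word
  `⁅s₁, g₁⁆ ⋯ ⁅s_d, g_d⁆ · ⁅y₁, u₁⁆ ⋯ ⁅y_n, u_n⁆ · w ^ p` (`sⱼ, uₐ, w ∈ P`): the set of such words
  is compact and maps onto the corresponding subgroup of every finite quotient `G ⧸ U`, by the
  finite-level engine `Literature.GroupTheory.Nilpotent.exists_eq_prod_commutator_mul_pow_of_normalClosure_eq`;
* `isClosed_operatorFrattini` — `M` is closed;
* `exists_openNormalSubgroup_inf_le_operatorFrattini` — `M` is open in `P`: some open normal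
  subgroup `U` of `G` has `U ∩ P ⊆ M`;
* `exists_openNormalSubgroup_forall_apply_eq_one` — consequently every ABSTRACT homomorphism
  `χ : G → A` to a commutative group of exponent `p` kills `U ∩ P` for some open normal `U`, i.e.
  `χ|_P` is continuous.

For `P = G` this is Serre's lemma.  The point of the relative version is that `P` itself need NOT be
topologically finitely generated (e.g. the wild inertia group of a `p`-adic field inside the absolute
Galois group, a free pro-`p` group of infinite rank that is normally generated by finitely many
elements).  Proof-only (no definitions); Mathlib + the two tree files imported.
[cite: DixonDuSautoyMannSegal1999, Ch. 1 Prop. 1.19, Thm. 1.17] [cite: SerreGaloisCohomology1997, I §4.2 ex. 6]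
-/

namespace Literature.GroupTheory.ProP

open Subgroup Topology
open scoped commutatorElement Pointwise

universe u v

variable {G : Type u} [Group G] [TopologicalSpace G] [IsTopologicalGroup G] [CompactSpace G]
  [TotallyDisconnectedSpace G]

/-! ### Finite quotients -/

omit [CompactSpace G] [TotallyDisconnectedSpace G] in
/-- In a continuous finite quotient `G ⧸ U` (`U` open normal), the image of the topological normal
closure `P` of `y₁, …, y_n` is the (abstract) normal closure of the images of the `yₐ`.
[cite: DixonDuSautoyMannSegal1999, Ch. 1 Prop. 1.19] -/
theorem map_mk_eq_normalClosure_range {n : ℕ} {y : Fin n → G} {P : Subgroup G}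
    (hyP : (Subgroup.normalClosure (Set.range y)).topologicalClosure = P)
    (U : Subgroup G) [U.Normal] (hU : IsOpen (U : Set G)) :
    P.map (QuotientGroup.mk' U) =
      Subgroup.normalClosure (Set.range fun a => (QuotientGroup.mk (y a) : G ⧸ U)) := by
  have hrange : (Set.range fun a => (QuotientGroup.mk (y a) : G ⧸ U)) =
      (QuotientGroup.mk' U) '' Set.range y := by
    rw [← Set.range_comp]; rfl
  rw [hrange, ← Subgroup.map_normalClosure _ _ (QuotientGroup.mk'_surjective U)]
  apply le_antisymm
  · rintro _ ⟨x, hx, rfl⟩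
    rw [← hyP] at hx
    -- the open coset `x • U` meets the dense subgroup `normalClosure (range y)`
    have hopen : IsOpen ((fun z => x⁻¹ * z) ⁻¹' (U : Set G)) := hU.preimage (by fun_prop)
    have hxc : x ∈ _root_.closure ((Subgroup.normalClosure (Set.range y) : Subgroup G) : Set G) := by
      rw [← Subgroup.topologicalClosure_coe]; exact hx
    obtain ⟨k, hkU, hk⟩ := _root_.mem_closure_iff.mp hxc _ hopen (by simp)
    have hq : (QuotientGroup.mk' U x : G ⧸ U) = QuotientGroup.mk' U k := by
      rw [QuotientGroup.mk'_apply, QuotientGroup.mk'_apply, QuotientGroup.eq]; exact hkU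
    rw [hq]
    exact Subgroup.mem_map_of_mem _ hk
  · exact Subgroup.map_mono (by rw [← hyP]; exact Subgroup.le_topologicalClosure _)

omit [IsTopologicalGroup G] [CompactSpace G] [TotallyDisconnectedSpace G] in
/-- The image in a continuous finite quotient of a pro-`p` subgroup is a `p`-group.
[cite: DixonDuSautoyMannSegal1999, Ch. 1 Prop. 1.19] -/
theorem isPGroup_map_mk {p : ℕ} {P : Subgroup G}
    (hP : ∀ x ∈ P, ∀ U : Subgroup G, IsOpen (U : Set G) → ∃ a : ℕ, x ^ (p ^ a) ∈ U)
    (U : Subgroup G) [U.Normal] (hU : IsOpen (U : Set G)) :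
    IsPGroup p (P.map (QuotientGroup.mk' U)) := by
  rintro ⟨q, hq⟩
  obtain ⟨x, hx, hxq⟩ := hq
  obtain ⟨a, ha⟩ := hP x hx U hU
  refine ⟨a, Subtype.ext ?_⟩
  have h1 : q ^ p ^ a = 1 := by
    rw [← hxq, ← map_pow, QuotientGroup.mk'_apply, QuotientGroup.eq_one_iff]
    exact ha
  simpa using h1

omit [TopologicalSpace G] [IsTopologicalGroup G] [CompactSpace G] [TotallyDisconnectedSpace G] in
/-- The image in a finite quotient of the abstract operator-Frattini subgroup of `P` is contained in
the operator-Frattini subgroup of the image of `P`. [cite: DixonDuSautoyMannSegal1999, Ch. 1 Prop. 1.19] -/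
theorem map_mk_operatorFrattini_le (p : ℕ) (P : Subgroup G) (U : Subgroup G) [U.Normal] :
    (Subgroup.closure ({x : G | ∃ w ∈ P, w ^ p = x} ∪ {x : G | ∃ w ∈ P, ∃ c : G, ⁅w, c⁆ = x})).map
        (QuotientGroup.mk' U) ≤
      Subgroup.closure ({x : G ⧸ U | ∃ w ∈ P.map (QuotientGroup.mk' U), w ^ p = x} ∪
        {x : G ⧸ U | ∃ w ∈ P.map (QuotientGroup.mk' U), ∃ c : G ⧸ U, ⁅w, c⁆ = x}) := by
  rw [MonoidHom.map_closure]
  apply Subgroup.closure_mono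
  rintro _ ⟨x, hx, rfl⟩
  rcases hx with ⟨w, hw, rfl⟩ | ⟨w, hw, c, rfl⟩
  · exact Or.inl ⟨QuotientGroup.mk' U w, Subgroup.mem_map_of_mem _ hw, by rw [map_pow]⟩
  · exact Or.inr ⟨QuotientGroup.mk' U w, Subgroup.mem_map_of_mem _ hw, QuotientGroup.mk' U c,
      by rw [map_commutatorElement]⟩

/-! ### The words -/

/-- **Bounded operator-Frattini words exhaust the closure of the operator-Frattini subgroup.**
Let `G` be profinite and topologically generated by `g₁, …, g_d`; let `P ⊴ G` be closed, pro-`p`, and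
the topological normal closure of `y₁, …, y_n ∈ P`.  Then every element of the closure of
`M = ⟨w ^ p, ⁅w, c⁆ : w ∈ P, c ∈ G⟩` equals `⁅s₁, g₁⁆ ⋯ ⁅s_d, g_d⁆ · ⁅y₁, u₁⁆ ⋯ ⁅y_n, u_n⁆ · w ^ p`
for some `sⱼ, uₐ, w ∈ P`. [cite: DixonDuSautoyMannSegal1999, Ch. 1 Prop. 1.19] -/
theorem exists_eq_word_of_mem_operatorFrattiniClosure {p : ℕ} [Fact p.Prime]
    {P : Subgroup G} [P.Normal] (hPc : IsClosed (P : Set G))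
    (hP : ∀ x ∈ P, ∀ U : Subgroup G, IsOpen (U : Set G) → ∃ a : ℕ, x ^ (p ^ a) ∈ U)
    {d : ℕ} {g : Fin d → G} (hg : (Subgroup.closure (Set.range g)).topologicalClosure = ⊤)
    {n : ℕ} {y : Fin n → G} (hy : ∀ a, y a ∈ P)
    (hyP : (Subgroup.normalClosure (Set.range y)).topologicalClosure = P)
    {t : G} (ht : t ∈ (Subgroup.closure
      ({x : G | ∃ w ∈ P, w ^ p = x} ∪ {x : G | ∃ w ∈ P, ∃ c : G, ⁅w, c⁆ = x})).topologicalClosure) :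
    ∃ (s : Fin d → G) (u : Fin n → G) (w : G), (∀ j, s j ∈ P) ∧ (∀ a, u a ∈ P) ∧ w ∈ P ∧
      t = (List.ofFn fun j => ⁅s j, g j⁆).prod * (List.ofFn fun a => ⁅y a, u a⁆).prod * w ^ p := by
  classical
  haveI : CompactSpace P := isCompact_iff_compactSpace.mp hPc.isCompact
  -- the compact set of words
  let wmap : (Fin d → P) × (Fin n → P) × P → G := fun suw =>
    (List.ofFn fun j => ⁅(suw.1 j : G), g j⁆).prod * (List.ofFn fun a => ⁅y a, (suw.2.1 a : G)⁆).prod *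
      (suw.2.2 : G) ^ p
  have hw : Continuous wmap := by
    refine Continuous.mul (Continuous.mul ?_ ?_) ((continuous_subtype_val.comp
      (continuous_snd.comp continuous_snd)).pow p)
    · refine continuous_prod_ofFn (fun j (suw : (Fin d → P) × (Fin n → P) × P) => ⁅(suw.1 j : G), g j⁆)
        (fun j => ?_)
      simp only [commutatorElement_def]
      fun_prop
    · refine continuous_prod_ofFn (fun a (suw : (Fin d → P) × (Fin n → P) × P) => ⁅y a, (suw.2.1 a : G)⁆)
        (fun a => ?_)
      simp only [commutatorElement_def]
      fun_prop
  have hX : IsClosed (Set.range wmap) := (isCompact_range hw).isClosed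
  suffices hmem : t ∈ Set.range wmap by
    obtain ⟨⟨s, u, w⟩, rfl⟩ := hmem
    exact ⟨fun j => s j, fun a => u a, w, fun j => (s j).2, fun a => (u a).2, w.2, rfl⟩
  by_contra hnot
  -- an open normal `U` with `t • U` disjoint from the words
  have hV : IsOpen ((fun z => t * z) ⁻¹' (Set.range wmap)ᶜ) := hX.isOpen_compl.preimage (by fun_prop)
  obtain ⟨U, hU⟩ := ProfiniteGrp.exist_openNormalSubgroup_sub_open_nhds_of_one hV
    (by simpa only [Set.mem_preimage, mul_one, Set.mem_compl_iff] using hnot)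
  -- the finite quotient `G ⧸ U`
  haveI : Finite (G ⧸ U.toSubgroup) := Subgroup.quotient_finite_of_isOpen U.toSubgroup U.isOpen
  have hgen := closure_range_mk_comp_eq_top hg U.toSubgroup U.isOpen
  set Pbar : Subgroup (G ⧸ U.toSubgroup) := P.map (QuotientGroup.mk' U.toSubgroup) with hPbar
  haveI hPbarN : Pbar.Normal := Subgroup.Normal.map inferInstance _ (QuotientGroup.mk'_surjective _)
  haveI : Finite Pbar := inferInstance
  haveI : Group.IsNilpotent Pbar := (isPGroup_map_mk hP U.toSubgroup U.isOpen).isNilpotent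
  have hybar : ∀ a, (QuotientGroup.mk (y a) : G ⧸ U.toSubgroup) ∈ Pbar := fun a =>
    Subgroup.mem_map_of_mem _ (hy a)
  have hyPbar : Subgroup.normalClosure (Set.range fun a => (QuotientGroup.mk (y a) : G ⧸ U.toSubgroup)) =
      Pbar := (map_mk_eq_normalClosure_range hyP U.toSubgroup U.isOpen).symm
  -- `mk t` lies in the operator-Frattini subgroup of `Pbar`
  have htU : (QuotientGroup.mk t : G ⧸ U.toSubgroup) ∈ Subgroup.closure
      ({x : G ⧸ U.toSubgroup | ∃ w ∈ Pbar, w ^ p = x} ∪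
        {x : G ⧸ U.toSubgroup | ∃ w ∈ Pbar, ∃ c : G ⧸ U.toSubgroup, ⁅w, c⁆ = x}) := by
    have hopen : IsOpen ((fun z => t⁻¹ * z) ⁻¹' (U : Set G)) := U.isOpen.preimage (by fun_prop)
    have htc : t ∈ _root_.closure ((Subgroup.closure
        ({x : G | ∃ w ∈ P, w ^ p = x} ∪ {x : G | ∃ w ∈ P, ∃ c : G, ⁅w, c⁆ = x}) : Subgroup G) : Set G) := by
      rw [← Subgroup.topologicalClosure_coe]; exact ht
    obtain ⟨h, hhU, hh⟩ := _root_.mem_closure_iff.mp htc _ hopen (by simp)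
    have hq : (QuotientGroup.mk t : G ⧸ U.toSubgroup) = QuotientGroup.mk' U.toSubgroup h := by
      rw [QuotientGroup.mk'_apply, QuotientGroup.eq]; exact hhU
    rw [hq]
    exact map_mk_operatorFrattini_le p P U.toSubgroup (Subgroup.mem_map_of_mem _ hh)
  obtain ⟨sbar, ubar, wbar, hsbar, hubar, hwbar, hword⟩ :=
    Literature.GroupTheory.Nilpotent.exists_eq_prod_commutator_mul_pow_of_normalClosure_eq
      (fun j => (QuotientGroup.mk (g j) : G ⧸ U.toSubgroup))
      (fun a => (QuotientGroup.mk (y a) : G ⧸ U.toSubgroup)) Pbar p hgen hybar hyPbar htU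
  -- lift the slots to `P`
  have hlift : ∀ q ∈ Pbar, ∃ x : P, (QuotientGroup.mk (x : G) : G ⧸ U.toSubgroup) = q := by
    intro q hq
    obtain ⟨x, hx, rfl⟩ := hq
    exact ⟨⟨x, hx⟩, rfl⟩
  choose s hs using fun j => hlift _ (hsbar j)
  choose u hu using fun a => hlift _ (hubar a)
  obtain ⟨w, hww⟩ := hlift _ hwbar
  have hmap : ∀ {m : ℕ} (h : Fin m → G), (QuotientGroup.mk (List.ofFn h).prod : G ⧸ U.toSubgroup) =
      (List.ofFn fun i => (QuotientGroup.mk (h i) : G ⧸ U.toSubgroup)).prod := by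
    intro m h
    rw [← QuotientGroup.mk'_apply, map_list_prod, List.map_ofFn]
    rfl
  have hwordG : (QuotientGroup.mk (wmap (s, u, w)) : G ⧸ U.toSubgroup) = QuotientGroup.mk t := by
    rw [hword]
    change QuotientGroup.mk ((List.ofFn fun j => ⁅(s j : G), g j⁆).prod *
      (List.ofFn fun a => ⁅y a, (u a : G)⁆).prod * (w : G) ^ p) = _
    rw [QuotientGroup.mk_mul, QuotientGroup.mk_mul, QuotientGroup.mk_pow, hww, hmap, hmap]
    congr 2
    · refine congrArg List.prod (congrArg List.ofFn (funext fun j => ?_))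
      rw [← QuotientGroup.mk'_apply, map_commutatorElement, QuotientGroup.mk'_apply, QuotientGroup.mk'_apply,
        hs j]
    · refine congrArg List.prod (congrArg List.ofFn (funext fun a => ?_))
      rw [← QuotientGroup.mk'_apply, map_commutatorElement, QuotientGroup.mk'_apply, QuotientGroup.mk'_apply,
        hu a]
  -- contradiction: `wmap (s, u, w) ∈ t • U ⊆ (range wmap)ᶜ`
  have hmemU : t⁻¹ * wmap (s, u, w) ∈ (U : Set G) := QuotientGroup.eq.mp hwordG.symm
  have := hU hmemU
  simp only [Set.mem_preimage, mul_inv_cancel_left, Set.mem_compl_iff, Set.mem_range_self,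
    not_true_eq_false] at this

/-- **The abstract operator-Frattini subgroup is closed.** Under the hypotheses of
`exists_eq_word_of_mem_operatorFrattiniClosure`, `M = ⟨w ^ p, ⁅w, c⁆ : w ∈ P, c ∈ G⟩` is closed.
[cite: DixonDuSautoyMannSegal1999, Ch. 1 Thm. 1.17] -/
theorem isClosed_operatorFrattini {p : ℕ} [Fact p.Prime]
    {P : Subgroup G} [P.Normal] (hPc : IsClosed (P : Set G))
    (hP : ∀ x ∈ P, ∀ U : Subgroup G, IsOpen (U : Set G) → ∃ a : ℕ, x ^ (p ^ a) ∈ U)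
    {d : ℕ} {g : Fin d → G} (hg : (Subgroup.closure (Set.range g)).topologicalClosure = ⊤)
    {n : ℕ} {y : Fin n → G} (hy : ∀ a, y a ∈ P)
    (hyP : (Subgroup.normalClosure (Set.range y)).topologicalClosure = P) :
    IsClosed ((Subgroup.closure
      ({x : G | ∃ w ∈ P, w ^ p = x} ∪ {x : G | ∃ w ∈ P, ∃ c : G, ⁅w, c⁆ = x}) : Subgroup G) : Set G) := by
  set M : Subgroup G := Subgroup.closure
      ({x : G | ∃ w ∈ P, w ^ p = x} ∪ {x : G | ∃ w ∈ P, ∃ c : G, ⁅w, c⁆ = x}) with hM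
  suffices h : M.topologicalClosure = M by
    rw [← h]; exact Subgroup.isClosed_topologicalClosure M
  refine le_antisymm (fun t ht => ?_) (Subgroup.le_topologicalClosure M)
  obtain ⟨s, u, w, hs, -, hw, rfl⟩ := exists_eq_word_of_mem_operatorFrattiniClosure hPc hP hg hy hyP ht
  refine mul_mem (mul_mem (list_prod_mem fun c hc => ?_) (list_prod_mem fun c hc => ?_))
    (Subgroup.subset_closure (Or.inl ⟨w, hw, rfl⟩))
  · rw [List.mem_ofFn] at hc
    obtain ⟨j, rfl⟩ := hc
    exact Subgroup.subset_closure (Or.inr ⟨s j, hs j, g j, rfl⟩)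
  · rw [List.mem_ofFn] at hc
    obtain ⟨a, rfl⟩ := hc
    exact Subgroup.subset_closure (Or.inr ⟨y a, hy a, u a, rfl⟩)

omit [TopologicalSpace G] [IsTopologicalGroup G] [CompactSpace G] [TotallyDisconnectedSpace G] in
/-- The abstract operator-Frattini subgroup `M = ⟨w ^ p, ⁅w, c⁆ : w ∈ P, c ∈ G⟩` of a normal
subgroup `P` is normal in `G`. [cite: DixonDuSautoyMannSegal1999, Ch. 1 Prop. 1.19] -/
theorem normal_operatorFrattini (p : ℕ) (P : Subgroup G) [P.Normal] :
    (Subgroup.closure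
      ({x : G | ∃ w ∈ P, w ^ p = x} ∪ {x : G | ∃ w ∈ P, ∃ c : G, ⁅w, c⁆ = x})).Normal := by
  set S : Set G := {x : G | ∃ w ∈ P, w ^ p = x} ∪ {x : G | ∃ w ∈ P, ∃ c : G, ⁅w, c⁆ = x} with hS
  have hconj : ∀ x ∈ S, ∀ c : G, c * x * c⁻¹ ∈ S := by
    rintro x hx c
    rcases hx with ⟨w, hw, rfl⟩ | ⟨w, hw, c', rfl⟩
    · refine Or.inl ⟨c * w * c⁻¹, Subgroup.Normal.conj_mem inferInstance _ hw _, ?_⟩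
      rw [conj_pow]
    · refine Or.inr ⟨c * w * c⁻¹, Subgroup.Normal.conj_mem inferInstance _ hw _, c * c' * c⁻¹, ?_⟩
      simp only [commutatorElement_def]; group
  have heq : Group.conjugatesOfSet S = S := by
    refine Set.Subset.antisymm ?_ Group.subset_conjugatesOfSet
    intro x hx
    obtain ⟨a, ha, hconj'⟩ := Group.mem_conjugatesOfSet_iff.mp hx
    obtain ⟨c, rfl⟩ := isConj_iff.mp hconj'
    exact hconj a ha c
  have : Subgroup.closure S = Subgroup.normalClosure S := by
    rw [Subgroup.normalClosure, heq]
  rw [this]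
  infer_instance

/-- **The abstract operator-Frattini subgroup is open in `P`.** Under the hypotheses of
`exists_eq_word_of_mem_operatorFrattiniClosure`, some open normal subgroup `U` of `G` satisfies
`U ∩ P ⊆ M = ⟨w ^ p, ⁅w, c⁆ : w ∈ P, c ∈ G⟩`.  (In `G ⧸ M`, which is `T₁` as `M` is closed, the
images of the `yₐ` are central of order dividing `p` and generate a finite subgroup containing the
image of `P`.) [cite: DixonDuSautoyMannSegal1999, Ch. 1 Thm. 1.17] -/
theorem exists_openNormalSubgroup_inf_le_operatorFrattini {p : ℕ} [Fact p.Prime]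
    {P : Subgroup G} [P.Normal] (hPc : IsClosed (P : Set G))
    (hP : ∀ x ∈ P, ∀ U : Subgroup G, IsOpen (U : Set G) → ∃ a : ℕ, x ^ (p ^ a) ∈ U)
    {d : ℕ} {g : Fin d → G} (hg : (Subgroup.closure (Set.range g)).topologicalClosure = ⊤)
    {n : ℕ} {y : Fin n → G} (hy : ∀ a, y a ∈ P)
    (hyP : (Subgroup.normalClosure (Set.range y)).topologicalClosure = P) :
    ∃ U : OpenNormalSubgroup G, (U : Subgroup G) ⊓ P ≤ Subgroup.closure
      ({x : G | ∃ w ∈ P, w ^ p = x} ∪ {x : G | ∃ w ∈ P, ∃ c : G, ⁅w, c⁆ = x}) := by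
  classical
  set M : Subgroup G := Subgroup.closure
      ({x : G | ∃ w ∈ P, w ^ p = x} ∪ {x : G | ∃ w ∈ P, ∃ c : G, ⁅w, c⁆ = x}) with hM
  haveI hMN : M.Normal := normal_operatorFrattini p P
  have hMc : IsClosed (M : Set G) := isClosed_operatorFrattini hPc hP hg hy hyP
  have hcomm : ∀ w ∈ P, ∀ c : G, ⁅w, c⁆ ∈ M := fun w hw c =>
    Subgroup.subset_closure (Or.inr ⟨w, hw, c, rfl⟩)
  have hpow : ∀ w ∈ P, w ^ p ∈ M := fun w hw => Subgroup.subset_closure (Or.inl ⟨w, hw, rfl⟩)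
  -- the quotient `Q = G ⧸ M` is `T₁`
  set Q := G ⧸ M
  haveI : T1Space Q := (QuotientGroup.t1Space_iff (N := M)).mpr hMc
  -- the images of the `yₐ` are central, of order dividing `p`
  have hcentral : ∀ w ∈ P, ∀ q : Q, (QuotientGroup.mk w : Q) * q = q * QuotientGroup.mk w := by
    intro w hw q
    obtain ⟨c, rfl⟩ := QuotientGroup.mk_surjective q
    rw [← QuotientGroup.mk_mul, ← QuotientGroup.mk_mul, QuotientGroup.eq]
    have : (w * c)⁻¹ * (c * w) = (⁅w⁻¹, c⁻¹⁆)⁻¹ := by simp only [commutatorElement_def]; group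
    rw [this]
    exact inv_mem (hcomm _ (inv_mem hw) _)
  set A : Subgroup Q := Subgroup.closure (Set.range fun a => (QuotientGroup.mk (y a) : Q)) with hA
  -- `A` is finite: commutative, finitely generated, `p`-torsion
  have hAcomm : ∀ a ∈ Set.range (fun a => (QuotientGroup.mk (y a) : Q)),
      ∀ b ∈ Set.range (fun a => (QuotientGroup.mk (y a) : Q)), a * b = b * a := by
    rintro _ ⟨a, rfl⟩ b -
    exact hcentral _ (hy a) b
  haveI : IsMulCommutative A := Subgroup.isMulCommutative_closure hAcomm
  haveI : Finite (Set.range fun a => (QuotientGroup.mk (y a) : Q)) := (Set.finite_range _).to_subtype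
  have htors : Monoid.IsTorsion A := by
    intro q
    refine isOfFinOrder_iff_pow_eq_one.mpr ⟨p, (Fact.out : p.Prime).pos, ?_⟩
    obtain ⟨q, hq⟩ := q
    apply Subtype.ext
    show q ^ p = 1
    -- elements of `A` are images of elements of `P`, whose `p`-th powers lie in `M`
    have hAP : A ≤ P.map (QuotientGroup.mk' M) := by
      rw [hA, Subgroup.closure_le]
      rintro _ ⟨a, rfl⟩
      exact Subgroup.mem_map_of_mem _ (hy a)
    obtain ⟨x, hx, rfl⟩ := hAP hq
    rw [QuotientGroup.mk'_apply, ← QuotientGroup.mk_pow, QuotientGroup.eq_one_iff]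
    exact hpow x hx
  haveI : Finite A := by
    open scoped IsMulCommutative in
    exact CommGroup.finite_of_fg_torsion (G := A) htors
  have hAclosed : IsClosed (A : Set Q) := (Set.toFinite (A : Set Q)).isClosed
  -- `A` is normal in `Q`: it is generated by central elements, hence central
  have hAcentral : ∀ q ∈ A, ∀ c : Q, c * q * c⁻¹ = q := by
    intro q hq c
    induction hq using Subgroup.closure_induction with
    | mem x hx =>
      obtain ⟨a, rfl⟩ := hx
      rw [← hcentral _ (hy a) c, mul_inv_cancel_right]
    | one => group
    | mul x x' _ _ hx hx' =>
      calc c * (x * x') * c⁻¹ = (c * x * c⁻¹) * (c * x' * c⁻¹) := by group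
        _ = x * x' := by rw [hx, hx']
    | inv x _ hx =>
      calc c * x⁻¹ * c⁻¹ = (c * x * c⁻¹)⁻¹ := by group
        _ = x⁻¹ := by rw [hx]
  haveI hAN : A.Normal := ⟨fun q hq c => by rw [hAcentral q hq c]; exact hq⟩
  -- the image of `P` in `Q` is contained in `A`
  have hPA : ∀ x ∈ P, (QuotientGroup.mk x : Q) ∈ A := by
    -- the normal closure of the `yₐ` maps into `A`
    have h1 : (Subgroup.normalClosure (Set.range y)).map (QuotientGroup.mk' M) ≤ A := by
      rw [Subgroup.map_normalClosure _ _ (QuotientGroup.mk'_surjective M)]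
      refine Subgroup.normalClosure_le_normal ?_
      rintro _ ⟨_, ⟨a, rfl⟩, rfl⟩
      exact Subgroup.subset_closure ⟨a, rfl⟩
    -- pass to the closure
    intro x hx
    rw [← hyP] at hx
    have hxc : x ∈ _root_.closure ((Subgroup.normalClosure (Set.range y) : Subgroup G) : Set G) := by
      rw [← Subgroup.topologicalClosure_coe]; exact hx
    have himg : (QuotientGroup.mk x : Q) ∈ _root_.closure ((QuotientGroup.mk : G → Q) ''
        ((Subgroup.normalClosure (Set.range y) : Subgroup G) : Set G)) :=
      image_closure_subset_closure_image continuous_quotient_mk' ⟨x, hxc, rfl⟩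
    have hsub : (QuotientGroup.mk : G → Q) '' ((Subgroup.normalClosure (Set.range y) : Subgroup G) : Set G)
        ⊆ (A : Set Q) := by
      rintro _ ⟨z, hz, rfl⟩
      exact h1 (Subgroup.mem_map_of_mem _ hz)
    exact hAclosed.closure_subset_iff.mpr hsub himg
  -- the finite set `A \ {1}` is closed; its complement is an open neighbourhood of `1`
  set F : Set Q := (A : Set Q) \ {1} with hF
  have hFc : IsClosed F := ((Set.toFinite (A : Set Q)).subset Set.sdiff_subset).isClosed
  have hV : IsOpen ((QuotientGroup.mk : G → Q) ⁻¹' Fᶜ) := hFc.isOpen_compl.preimage continuous_quotient_mk'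
  have h1V : (1 : G) ∈ (QuotientGroup.mk : G → Q) ⁻¹' Fᶜ := by
    simp only [hF, Set.mem_preimage, QuotientGroup.mk_one, Set.mem_compl_iff, Set.mem_sdiff,
      Set.mem_singleton_iff, not_true_eq_false, and_false, not_false_eq_true]
  obtain ⟨U, hU⟩ := ProfiniteGrp.exist_openNormalSubgroup_sub_open_nhds_of_one hV h1V
  refine ⟨U, fun x hx => ?_⟩
  have hxA : (QuotientGroup.mk x : Q) ∈ A := hPA x hx.2
  have hxF : (QuotientGroup.mk x : Q) ∉ F := hU hx.1
  have hx1 : (QuotientGroup.mk x : Q) = 1 := by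
    by_contra hne
    exact hxF ⟨hxA, hne⟩
  exact (QuotientGroup.eq_one_iff x).mp hx1

/-- **Operator Serre lemma, character form.** Under the hypotheses of
`exists_eq_word_of_mem_operatorFrattiniClosure` (`G` profinite topologically generated by
`g₁, …, g_d`; `P ⊴ G` closed, pro-`p`, topologically normally generated by `y₁, …, y_n`), every
ABSTRACT homomorphism `χ : G → A` into a commutative group of exponent `p` kills `U ∩ P` for some
open normal subgroup `U` of `G`; i.e. the restriction of `χ` to `P` is continuous.
[cite: SerreGaloisCohomology1997, I §4.2 ex. 6] [cite: DixonDuSautoyMannSegal1999, Ch. 1 Thm. 1.17] -/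
theorem exists_openNormalSubgroup_forall_apply_eq_one {p : ℕ} [Fact p.Prime]
    {P : Subgroup G} [P.Normal] (hPc : IsClosed (P : Set G))
    (hP : ∀ x ∈ P, ∀ U : Subgroup G, IsOpen (U : Set G) → ∃ a : ℕ, x ^ (p ^ a) ∈ U)
    {d : ℕ} {g : Fin d → G} (hg : (Subgroup.closure (Set.range g)).topologicalClosure = ⊤)
    {n : ℕ} {y : Fin n → G} (hy : ∀ a, y a ∈ P)
    (hyP : (Subgroup.normalClosure (Set.range y)).topologicalClosure = P)
    {A : Type v} [CommGroup A] (χ : G →* A) (hA : ∀ a : A, a ^ p = 1) :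
    ∃ U : OpenNormalSubgroup G, ∀ x ∈ (U : Subgroup G) ⊓ P, χ x = 1 := by
  obtain ⟨U, hU⟩ := exists_openNormalSubgroup_inf_le_operatorFrattini hPc hP hg hy hyP
  refine ⟨U, fun x hx => ?_⟩
  have hle : Subgroup.closure
      ({x : G | ∃ w ∈ P, w ^ p = x} ∪ {x : G | ∃ w ∈ P, ∃ c : G, ⁅w, c⁆ = x}) ≤ χ.ker := by
    rw [Subgroup.closure_le]
    rintro _ (⟨w, -, rfl⟩ | ⟨w, -, c, rfl⟩)
    · rw [SetLike.mem_coe, MonoidHom.mem_ker, map_pow, hA]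
    · rw [SetLike.mem_coe, MonoidHom.mem_ker, map_commutatorElement, commutatorElement_eq_one_iff_commute]
      exact Commute.all _ _
  exact hle (hU hx)

end Literature.GroupTheory.ProP
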